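import Summits.BirchSwinnertonDyer.BirchSwinnertonDyer.Theorems.ResidualThetaTransportAtTwoThetaLayerLambdaCongruenceAtTwoStarPlusLineCharTwo
import Summits.BirchSwinnertonDyer.BirchSwinnertonDyer.Theorems.ResidualThetaTransportAtTwoThetaLayerLambdaCongruenceAtTwoResidualReduction
import HarnessLib

/-!
# Crux `ThetaLayerLambdaCongruenceAtTwo`, line `birth`: (C3k⁺) ⟹ (C3⁺) (residue-field reduction with level hypotheses)

Helper file for `stmt-BirchSwinnertonDyer-20688` (no definition, no new obligation).  `…StarPlusLineCharTwo` proves the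
characteristic-`2` plus-line statement (C3k) at the levels `N'` with `N_W·∏_{ℓ∈S} ℓ² ∣ N'`, `primes(N') ⊆ S`, good
reduction off `2N'` (the crux's level qualifies) from six named facts.  This file transports it to the `2`-adic form (C3)
with the same level hypotheses — the proof is the lead's `plusLineAtTwo_of_charTwo` (`…ResidualReduction`) with the extra
hypotheses passed through unchanged.  BSD is not proved by any of this.
-/

noncomputable section

-- justification: the `Summit.BirchSwinnertonDyer.BirchSwinnertonDyer.…` path repeats a component (route-file convention)
set_option linter.dupNamespace false

open scoped Classical MatrixGroups

open CongruenceSubgroup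

namespace Summit.BirchSwinnertonDyer.BirchSwinnertonDyer.Theorems.ThetaLayerLambdaCongruenceAtTwo

/-- **(C3k⁺) ⟹ (C3⁺): the residue-field form of «plus multiplicity one mod 2» implies the `2`-adic form, with the
LEVEL HYPOTHESES threaded through.**  Verbatim the lead's `plusLineAtTwo_of_charTwo` (`…ResidualReduction`: reduce two
integral primitive symbol functions modulo the maximal ideal of `𝒪_{ℚ̄₂}`, apply the characteristic-`2` statement, lift
the scalar), except that the hypothesis «`N'` divisible by the primes of `N_W`» of (C3k)/(C3) is replaced on both sides by
the level hypotheses of `plusLineCharTwo_of_facts` (a newform `f` of `W` of level `N`, a nonempty finite set of primes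
`S` with `N·∏_{ℓ∈S} ℓ² ∣ N'`, `primes(N') ⊆ S`, good reduction off `2N'`), which are merely passed along.
[cite: GreenbergVatsal2000, §3] -/
theorem plusLineAtTwoLevel_of_charTwoLevel
    (hk : ∀ (W : WeierstrassCurve ℚ) [W.IsElliptic] [W.IsGloballyMinimal], Literature.NumberTheory.EllipticCurves.Rank1Residual.GoodSS W 2 → W.Δ < 0 → ∀ (N' : ℕ), Odd N' → ∀ {N : ℕ} [NeZero N] (f : CuspForm (CongruenceSubgroup.Gamma0 N) 2), Literature.NumberTheory.EllipticCurves.ModularForms.IsNewformOf W f → ∀ (S : Finset ℕ), (∀ ℓ ∈ S, ℓ.Prime) → S.Nonempty → N * ∏ ℓ ∈ S, ℓ ^ 2 ∣ N' → (∀ p : ℕ, p.Prime → p ∣ N' → p ∈ S) → (∀ v : IsDedekindDomain.HeightOneSpectrum (NumberField.RingOfIntegers ℚ), ¬ ((Rat.HeightOneSpectrum.primesEquiv v : ℕ) ∣ 2 * N') → W.HasGoodReductionAt v) → ∀ (k : Type) [Field k] [CharP k 2] (Ψ₁ Ψ₂ : ℚ → k), (∀ (r : ℚ) (z : ℤ),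 Ψ₁ (r + z) = Ψ₁ r) → (∀ r : ℚ, Ψ₁ (-r) = Ψ₁ r) → (∀ (γ : CongruenceSubgroup.Gamma0 (N')) (r : ℚ), ((γ : SL(2, ℤ)) 1 0 : ℚ) * r + ((γ : SL(2, ℤ)) 1 1 : ℚ) ≠ 0 → Ψ₁ ((((γ : SL(2, ℤ)) 0 0 : ℚ) * r + ((γ : SL(2, ℤ)) 0 1 : ℚ)) / (((γ : SL(2, ℤ)) 1 0 : ℚ) * r + ((γ : SL(2, ℤ)) 1 1 : ℚ))) = (if ((γ : SL(2, ℤ)) 1 0) = 0 then 0 else Ψ₁ ((((γ : SL(2, ℤ)) 0 0 : ℚ)) / (((γ : SL(2, ℤ)) 1 0 : ℚ)))) + Ψ₁ r) → (∀ (r : ℚ) (z : ℤ), Ψ₂ (r + z) = Ψ₂ r) → (∀ r : ℚ, Ψ₂ (-r) = Ψ₂ r) → (∀ (γ : CongruenceSubgroup.Gamma0 (N')) (r : ℚ), ((γ : SL(2, ℤ)) 1 0 : ℚ) * r + ((γ : SL(2, ℤ)) 1 1 : ℚ) ≠ 0 → Ψ₂ ((((γ : SL(2, ℤ)) 0 0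 : ℚ) * r + ((γ : SL(2, ℤ)) 0 1 : ℚ)) / (((γ : SL(2, ℤ)) 1 0 : ℚ) * r + ((γ : SL(2, ℤ)) 1 1 : ℚ))) = (if ((γ : SL(2, ℤ)) 1 0) = 0 then 0 else Ψ₂ ((((γ : SL(2, ℤ)) 0 0 : ℚ)) / (((γ : SL(2, ℤ)) 1 0 : ℚ)))) + Ψ₂ r) → (∃ r : ℚ, Ψ₁ r ≠ 0) → (∃ r : ℚ, Ψ₂ r ≠ 0) → (∀ q : ℕ, q.Prime → ¬ q ∣ N' → ∀ r : ℚ, (∑ j : Fin q, Ψ₁ ((r + j) / q)) + Ψ₁ (q * r) = (W.LFunction q : k) * Ψ₁ r) → (∀ q : ℕ, q.Prime → ¬ q ∣ N' → ∀ r : ℚ, (∑ j : Fin q, Ψ₂ ((r + j) / q)) + Ψ₂ (q * r) = (W.LFunction q : k) * Ψ₂ r) → (∀ ℓ : ℕ, ℓ.Prime → ℓ ∣ N' → ∀ r : ℚ, ∑ j : Fin ℓ, Ψ₁ ((r + j) / ℓ) = 0) → (∀ ℓ : ℕ, ℓ.Prime → ℓ ∣ N' → ∀ r : ℚ, ∑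 j : Fin ℓ, Ψ₂ ((r + j) / ℓ) = 0) → ∃ c : k, ∀ r : ℚ, Ψ₂ r = c * Ψ₁ r) :
    ∀ (W : WeierstrassCurve ℚ) [W.IsElliptic] [W.IsGloballyMinimal], Literature.NumberTheory.EllipticCurves.Rank1Residual.GoodSS W 2 → W.Δ < 0 → ∀ (N' : ℕ), Odd N' → ∀ {N : ℕ} [NeZero N] (f : CuspForm (CongruenceSubgroup.Gamma0 N) 2), Literature.NumberTheory.EllipticCurves.ModularForms.IsNewformOf W f → ∀ (S : Finset ℕ), (∀ ℓ ∈ S, ℓ.Prime) → S.Nonempty → N * ∏ ℓ ∈ S, ℓ ^ 2 ∣ N' → (∀ p : ℕ, p.Prime → p ∣ N' → p ∈ S) → (∀ v : IsDedekindDomain.HeightOneSpectrum (NumberField.RingOfIntegers ℚ), ¬ ((Rat.HeightOneSpectrum.primesEquiv v : ℕ) ∣ 2 * N') → W.HasGoodReductionAt v) → ∀ (Φ₁ Φ₂ : ℚ → PadicAlgCl 2), (∀ (r : ℚ) (z : ℤ), Φ₁ (r + z) = Φ₁ r) → (∀ r : ℚ, Φ₁ (-r) = Φ₁ r) → (∀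 (γ : CongruenceSubgroup.Gamma0 (N')) (r : ℚ), ((γ : SL(2, ℤ)) 1 0 : ℚ) * r + ((γ : SL(2, ℤ)) 1 1 : ℚ) ≠ 0 → Φ₁ ((((γ : SL(2, ℤ)) 0 0 : ℚ) * r + ((γ : SL(2, ℤ)) 0 1 : ℚ)) / (((γ : SL(2, ℤ)) 1 0 : ℚ) * r + ((γ : SL(2, ℤ)) 1 1 : ℚ))) = (if ((γ : SL(2, ℤ)) 1 0) = 0 then 0 else Φ₁ ((((γ : SL(2, ℤ)) 0 0 : ℚ)) / (((γ : SL(2, ℤ)) 1 0 : ℚ)))) + Φ₁ r) → (∀ (r : ℚ) (z : ℤ), Φ₂ (r + z) = Φ₂ r) → (∀ r : ℚ, Φ₂ (-r) = Φ₂ r) → (∀ (γ : CongruenceSubgroup.Gamma0 (N')) (r : ℚ), ((γ : SL(2, ℤ)) 1 0 : ℚ) * r + ((γ : SL(2, ℤ)) 1 1 : ℚ) ≠ 0 → Φ₂ ((((γ : SL(2, ℤ)) 0 0 : ℚ) * r + ((γ : SL(2, ℤ)) 0 1 : ℚ)) / (((γ : SL(2, ℤ)) 1 0 : ℚ) * r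 + ((γ : SL(2, ℤ)) 1 1 : ℚ))) = (if ((γ : SL(2, ℤ)) 1 0) = 0 then 0 else Φ₂ ((((γ : SL(2, ℤ)) 0 0 : ℚ)) / (((γ : SL(2, ℤ)) 1 0 : ℚ)))) + Φ₂ r) → (∀ r : ℚ, ‖Φ₁ r‖ ≤ 1) → (∀ r : ℚ, ‖Φ₂ r‖ ≤ 1) → (∃ r : ℚ, ‖Φ₁ r‖ = 1) → (∃ r : ℚ, ‖Φ₂ r‖ = 1) → (∀ q : ℕ, q.Prime → ¬ q ∣ N' → ∀ r : ℚ, ‖(∑ j : Fin q, Φ₁ ((r + j) / q)) + Φ₁ (q * r) - (W.LFunction q : PadicAlgCl 2) * Φ₁ r‖ < 1) → (∀ q : ℕ, q.Prime → ¬ q ∣ N' → ∀ r : ℚ, ‖(∑ j : Fin q, Φ₂ ((r + j) / q)) + Φ₂ (q * r) - (W.LFunction q : PadicAlgCl 2) * Φ₂ r‖ < 1) → (∀ ℓ : ℕ, ℓ.Prime → ℓ ∣ N' → ∀ r : ℚ, ‖∑ j : Fin ℓ, Φ₁ ((r + j) / ℓ)‖ < 1) → (∀ ℓ : ℕ, ℓ.Prime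 → ℓ ∣ N' → ∀ r : ℚ, ‖∑ j : Fin ℓ, Φ₂ ((r + j) / ℓ)‖ < 1) → ∃ a : PadicAlgCl 2, ∀ r : ℚ, ‖a * Φ₁ r - Φ₂ r‖ < 1 := by
  intro W _ _ hss hΔ N' hN' N _ f hf S hS hSne hNL hLS hgood Φ₁ Φ₂ hper₁ hev₁ hM₁ hper₂ hev₂ hM₂ hle₁ hle₂ hprim₁ hprim₂ hT₁ hT₂ hU₁ hU₂
  haveI := charP_residueField_two
  -- the reductions `Ψᵢ = Φᵢ mod 𝔪 : ℚ → 𝓀`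
  set res := IsLocalRing.residue (Valued.integer (PadicAlgCl 2)) with hres
  have m₁ : ∀ r : ℚ, Φ₁ r ∈ Valued.integer (PadicAlgCl 2) :=
    fun r ↦ mem_integer_two_iff_norm_le_one.mpr (hle₁ r)
  have m₂ : ∀ r : ℚ, Φ₂ r ∈ Valued.integer (PadicAlgCl 2) :=
    fun r ↦ mem_integer_two_iff_norm_le_one.mpr (hle₂ r)
  set Ψ₁ : ℚ → IsLocalRing.ResidueField (Valued.integer (PadicAlgCl 2)) := fun r ↦ res ⟨Φ₁ r, m₁ r⟩ with hΨ₁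
  set Ψ₂ : ℚ → IsLocalRing.ResidueField (Valued.integer (PadicAlgCl 2)) := fun r ↦ res ⟨Φ₂ r, m₂ r⟩ with hΨ₂
  -- generic transfer lemmas for a reduction `Ψ = Φ mod 𝔪`
  have transfer_per : ∀ (Φ : ℚ → PadicAlgCl 2) (m : ∀ r : ℚ, Φ r ∈ Valued.integer (PadicAlgCl 2)),
      (∀ (r : ℚ) (z : ℤ), Φ (r + z) = Φ r) → ∀ (r : ℚ) (z : ℤ),
        res ⟨Φ (r + z), m (r + z)⟩ = res ⟨Φ r, m r⟩ := by
    intro Φ m hper r z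
    congr 1
    exact Subtype.ext (hper r z)
  have transfer_ev : ∀ (Φ : ℚ → PadicAlgCl 2) (m : ∀ r : ℚ, Φ r ∈ Valued.integer (PadicAlgCl 2)),
      (∀ r : ℚ, Φ (-r) = Φ r) → ∀ r : ℚ, res ⟨Φ (-r), m (-r)⟩ = res ⟨Φ r, m r⟩ := by
    intro Φ m hev r
    congr 1
    exact Subtype.ext (hev r)
  have transfer_M : ∀ (Φ : ℚ → PadicAlgCl 2) (m : ∀ r : ℚ, Φ r ∈ Valued.integer (PadicAlgCl 2)),
      (∀ (γ : CongruenceSubgroup.Gamma0 (N')) (r : ℚ), ((γ : SL(2, ℤ)) 1 0 : ℚ) * r + ((γ : SL(2, ℤ)) 1 1 : ℚ) ≠ 0 → Φ ((((γ : SL(2, ℤ)) 0 0 : ℚ) * r + ((γ : SL(2, ℤ)) 0 1 : ℚ)) / (((γ : SL(2, ℤ)) 1 0 : ℚ) * r + ((γ : SL(2, ℤ)) 1 1 : ℚ))) = (if ((γ : SL(2, ℤ)) 1 0) = 0 then 0 else Φ ((((γ : SL(2, ℤ)) 0 0 : ℚ)) / (((γ : SL(2, ℤ)) 1 0 : ℚ))))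 + Φ r) →
      ∀ (γ : CongruenceSubgroup.Gamma0 (N')) (r : ℚ), ((γ : SL(2, ℤ)) 1 0 : ℚ) * r + ((γ : SL(2, ℤ)) 1 1 : ℚ) ≠ 0 →
        res ⟨Φ ((((γ : SL(2, ℤ)) 0 0 : ℚ) * r + ((γ : SL(2, ℤ)) 0 1 : ℚ)) / (((γ : SL(2, ℤ)) 1 0 : ℚ) * r + ((γ : SL(2, ℤ)) 1 1 : ℚ))), m _⟩ =
          (if ((γ : SL(2, ℤ)) 1 0) = 0 then 0 else res ⟨Φ ((((γ : SL(2, ℤ)) 0 0 : ℚ)) / (((γ : SL(2, ℤ)) 1 0 : ℚ))), m _⟩) + res ⟨Φ r, m r⟩ := by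
    intro Φ m hM γ r hr
    have h := hM γ r hr
    by_cases hc : (γ : SL(2, ℤ)) 1 0 = 0
    · rw [if_pos hc, zero_add] at h
      rw [if_pos hc, zero_add]
      congr 1
      exact Subtype.ext h
    · rw [if_neg hc] at h
      rw [if_neg hc, ← map_add]
      congr 1
      exact Subtype.ext h
  have transfer_ne : ∀ (Φ : ℚ → PadicAlgCl 2) (m : ∀ r : ℚ, Φ r ∈ Valued.integer (PadicAlgCl 2)),
      (∃ r : ℚ, ‖Φ r‖ = 1) → ∃ r : ℚ, res ⟨Φ r, m r⟩ ≠ 0 := by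
    rintro Φ m ⟨r, hr⟩
    refine ⟨r, fun h ↦ ?_⟩
    have := (residue_two_mk_eq_zero_iff (m r)).mp h
    rw [hr] at this
    exact lt_irrefl _ this
  have transfer_T : ∀ (Φ : ℚ → PadicAlgCl 2) (m : ∀ r : ℚ, Φ r ∈ Valued.integer (PadicAlgCl 2)),
      (∀ q : ℕ, q.Prime → ¬ q ∣ N' → ∀ r : ℚ, ‖(∑ j : Fin q, Φ ((r + j) / q)) + Φ (q * r) - (W.LFunction q : PadicAlgCl 2) * Φ r‖ < 1) →
      ∀ q : ℕ, q.Prime → ¬ q ∣ N' → ∀ r : ℚ, (∑ j : Fin q, res ⟨Φ ((r + j) / q), m _⟩) + res ⟨Φ (q * r), m _⟩ =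
        (W.LFunction q : IsLocalRing.ResidueField (Valued.integer (PadicAlgCl 2))) * res ⟨Φ r, m r⟩ := by
    intro Φ m hT q hq hqN r
    have ma : ((W.LFunction q : ℤ) : PadicAlgCl 2) ∈ Valued.integer (PadicAlgCl 2) :=
      mem_integer_two_iff_norm_le_one.mpr (norm_intCast_padicAlgCl_two_le_one _)
    -- the element `T_qΦ(r) − a_q Φ(r)` of `𝒪`
    set E : Valued.integer (PadicAlgCl 2) :=
      (∑ j : Fin q, (⟨Φ ((r + j) / q), m _⟩ : Valued.integer (PadicAlgCl 2))) + ⟨Φ (q * r), m _⟩ -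
        ⟨((W.LFunction q : ℤ) : PadicAlgCl 2), ma⟩ * ⟨Φ r, m r⟩ with hE
    have hEval : (E : PadicAlgCl 2) =
        (∑ j : Fin q, Φ ((r + j) / q)) + Φ (q * r) - (W.LFunction q : PadicAlgCl 2) * Φ r := by
      rw [hE]; push_cast; rfl
    have hE0 : res E = 0 := by
      rw [hres, residue_two_eq_zero_iff, hEval]; exact hT q hq hqN r
    rw [hE, map_sub, map_add, map_sum, map_mul, sub_eq_zero] at hE0
    rw [hE0, residue_two_mk_intCast _ ma]
  have transfer_U : ∀ (Φ : ℚ → PadicAlgCl 2) (m : ∀ r : ℚ, Φ r ∈ Valued.integer (PadicAlgCl 2)),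
      (∀ ℓ : ℕ, ℓ.Prime → ℓ ∣ N' → ∀ r : ℚ, ‖∑ j : Fin ℓ, Φ ((r + j) / ℓ)‖ < 1) →
      ∀ ℓ : ℕ, ℓ.Prime → ℓ ∣ N' → ∀ r : ℚ, ∑ j : Fin ℓ, res ⟨Φ ((r + j) / ℓ), m _⟩ = 0 := by
    intro Φ m hU ℓ hℓ hℓN r
    set E : Valued.integer (PadicAlgCl 2) :=
      ∑ j : Fin ℓ, (⟨Φ ((r + j) / ℓ), m _⟩ : Valued.integer (PadicAlgCl 2)) with hE
    have hEval : (E : PadicAlgCl 2) = ∑ j : Fin ℓ, Φ ((r + j) / ℓ) := by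
      rw [hE]; push_cast; rfl
    have hE0 : res E = 0 := by
      rw [hres, residue_two_eq_zero_iff, hEval]; exact hU ℓ hℓ hℓN r
    rw [hE, map_sum] at hE0
    exact hE0
  -- apply (C3k) in the residue field
  obtain ⟨c, hc⟩ := hk W hss hΔ N' hN' f hf S hS hSne hNL hLS hgood (IsLocalRing.ResidueField (Valued.integer (PadicAlgCl 2))) Ψ₁ Ψ₂
    (transfer_per Φ₁ m₁ hper₁) (transfer_ev Φ₁ m₁ hev₁) (transfer_M Φ₁ m₁ hM₁)
    (transfer_per Φ₂ m₂ hper₂) (transfer_ev Φ₂ m₂ hev₂) (transfer_M Φ₂ m₂ hM₂)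
    (transfer_ne Φ₁ m₁ hprim₁) (transfer_ne Φ₂ m₂ hprim₂)
    (transfer_T Φ₁ m₁ hT₁) (transfer_T Φ₂ m₂ hT₂) (transfer_U Φ₁ m₁ hU₁) (transfer_U Φ₂ m₂ hU₂)
  -- lift the scalar
  obtain ⟨a, ha⟩ := IsLocalRing.residue_surjective c
  refine ⟨(a : PadicAlgCl 2), fun r ↦ ?_⟩
  have hmem : (a : PadicAlgCl 2) * Φ₁ r - Φ₂ r ∈ Valued.integer (PadicAlgCl 2) :=
    sub_mem (mul_mem a.2 (m₁ r)) (m₂ r)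
  refine (residue_two_mk_eq_zero_iff hmem).mp ?_
  have e : (⟨(a : PadicAlgCl 2) * Φ₁ r - Φ₂ r, hmem⟩ : Valued.integer (PadicAlgCl 2)) =
      a * ⟨Φ₁ r, m₁ r⟩ - ⟨Φ₂ r, m₂ r⟩ := Subtype.ext rfl
  rw [e, map_sub, map_mul, ← hres, ha]
  change c * Ψ₁ r - Ψ₂ r = 0
  rw [hc r, sub_self]


end Summit.BirchSwinnertonDyer.BirchSwinnertonDyer.Theorems.ThetaLayerLambdaCongruenceAtTwo

end
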